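import Literature.Computability.Complexity.TruthTableFunctions
import HarnessLib

/-!
# Truth-table oracle transducers against arbitrary oracles: the function `x ↦ G ⟨x, ⟨answers⟩⟩`

Trunk `CplxCore`, a companion of `TruthTableFunctions.lean`. There, `ttFnAlg Q q G` asks the
non-adaptive queries `Q ⟨x, 1ⁱ⟩`, `i < q(|x|)`, and outputs `G ⟨x, b₀ b₁ ⋯⟩` on the FLATTENED
one-bit answers of a *language* oracle (`run_ttFnAlg` is about `Oracle.ofLanguage A`). A
reduction that is handed an ARBITRARY oracle `O : {0,1}* → {0,1}*` (e.g. an LWE distinguisher whose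
verdict is the first bit of its answer, `LWEHardness.lean`) must not flatten the answers (their
boundaries would be lost); instead its output map reads the `listBool`-CODED transcript
`⟨1^{#answers}, ⟨a₀, ⟨a₁, … ⟨a_{k-1}, ε⟩…⟩⟩⟩`, which is exactly the second field of the
step-function input of `OracleAlg.IsPolyTime`. This file provides that variant:

* `ttFnAlgL Q q G` — ask `Q ⟨x, 1ⁱ⟩` for `i < q(|x|)`, then output `G ⟨x, code of the answers⟩`;
* `ttQueries Q x k` — the list of the first `k` intended queries; `trans_ttFnAlgL` — against ANY
  oracle `O` the transcript after `i ≤ q(|x|)` rounds is `(ttQueries Q x i).map O`;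
* `run_ttFnAlgL` — within any budget of more than `q(|x|)` rounds the run outputs
  `ttFnL Q q G O x = G ⟨x, code ((ttQueries Q x (q |x|)).map O)⟩`; `exists_of_mem_queries_ttFnAlgL`
  — only intended queries are asked;
* `isPolyTime_ttFnAlgL` — the step function is polynomial-time for `Q, G ∈ FP` (the string map is
  `condFn (GoOn q) (qryS Q) (List.cons true ∘ G)`: the output branch is `G` itself applied to the
  step input, no transducer needed).

This is the shape of Regev's search-to-decision reduction for LWE (all oracle calls are on
transformed fresh samples computed from the input alone; the secret is then read off the answer
bits), cf. Ladner–Lynch–Selman's truth-table reducibility for transducers.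

## References

* R. E. Ladner, N. A. Lynch, A. L. Selman, *A comparison of polynomial time reducibilities*,
  Theoret. Comput. Sci. 1 (1975) 103–123, §3 (`≤ᵖₜₜ`: generator and evaluator; `≤ᵖₜₜ ⇒ ≤ᵖ_T`).
* S. Arora, B. Barak, *Computational Complexity: A Modern Approach*, CUP 2009, §3.4 (oracle
  machines).
* O. Regev, *On lattices, learning with errors, random linear codes, and cryptography*, J. ACM 56
  (2009), §4 (the reductions `W'` call `W` on transformed samples only).
-/

namespace Literature.Computability.Complexity

open _root_.Computability Polynomial PRelSigma OracleCompose TTClosure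

section TTFnL

variable (Q : List Bool → List Bool) (q : Polynomial ℕ) (G : List Bool → List Bool)

/-- The first `k` intended queries on input `x`: `[Q ⟨x, 1⁰⟩, …, Q ⟨x, 1^{k-1}⟩]`.
[Ladner–Lynch–Selman 1975, §3 (the query generator of a `tt`-reduction)] [cite: LadnerLynchSelman1975, §3] -/
def ttQueries (x : List Bool) (k : ℕ) : List (List Bool) :=
  (List.range k).map fun i => Q (boolPair x (List.replicate i true))

/-- **The truth-table transducer reading coded answers**: while fewer than `q(|x|)` answers have
been received, ask `Q ⟨x, 1^{#answers}⟩`; then output `G ⟨x, code of the answer list⟩`, the answers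
being kept as the `listBool` code `⟨1^{#answers}, ⟨a₀, ⟨a₁, …⟩⟩⟩` (so that an arbitrary oracle's
answer strings stay separated). [Ladner–Lynch–Selman 1975, §3] [cite: LadnerLynchSelman1975, §3] -/
noncomputable def ttFnAlgL : OracleAlg (List Bool) where
  step x ans :=
    if ans.length < q.eval x.length then Sum.inl (Q (boolPair x (List.replicate ans.length true)))
    else Sum.inr (G (boolPair x ((encodingList Bool).listBool.encode ans)))

/-- **The function computed from the oracle `O`**: `x ↦ G ⟨x, code [O q₀, …, O q_{q(|x|)-1}]⟩` with
`qᵢ = Q ⟨x, 1ⁱ⟩`. [Ladner–Lynch–Selman 1975, §3] [cite: LadnerLynchSelman1975, §3] -/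
noncomputable def ttFnL (O : Oracle) (x : List Bool) : List Bool :=
  G (boolPair x ((encodingList Bool).listBool.encode ((ttQueries Q x (q.eval x.length)).map O)))

variable {Q q G}

/-- `ttQueries` at `0` is empty. [folklore] -/
@[simp] theorem ttQueries_zero (x : List Bool) : ttQueries Q x 0 = [] := rfl

/-- One more intended query. [folklore] -/
theorem ttQueries_succ (x : List Bool) (k : ℕ) :
    ttQueries Q x (k + 1) = ttQueries Q x k ++ [Q (boolPair x (List.replicate k true))] := by
  simp [ttQueries, List.range_succ]

/-- There are `k` intended queries among the first `k`. [folklore] -/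
@[simp] theorem length_ttQueries (x : List Bool) (k : ℕ) : (ttQueries Q x k).length = k := by
  simp [ttQueries]

/-- The `i`-th intended query. [folklore] -/
theorem getElem_ttQueries (x : List Bool) {k i : ℕ} (hi : i < (ttQueries Q x k).length) :
    (ttQueries Q x k)[i] = Q (boolPair x (List.replicate i true)) := by
  simp [ttQueries]

/-- Membership in the list of intended queries. [folklore] -/
theorem mem_ttQueries_iff (x : List Bool) (k : ℕ) (y : List Bool) :
    y ∈ ttQueries Q x k ↔ ∃ i < k, y = Q (boolPair x (List.replicate i true)) := by
  simp only [ttQueries, List.mem_map, List.mem_range]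
  constructor
  · rintro ⟨i, hi, rfl⟩; exact ⟨i, hi, rfl⟩
  · rintro ⟨i, hi, rfl⟩; exact ⟨i, hi, rfl⟩

/-- Unfolding lemma for `ttFnL`. [folklore] -/
theorem ttFnL_apply (O : Oracle) (x : List Bool) :
    ttFnL Q q G O x =
      G (boolPair x ((encodingList Bool).listBool.encode ((ttQueries Q x (q.eval x.length)).map O))) :=
  rfl

/-- The step of `ttFnAlgL` before the last query has been answered is the next query. [folklore] -/
theorem ttFnAlgL_step_of_lt (x : List Bool) {ans : List (List Bool)} (h : ans.length < q.eval x.length) :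
    (ttFnAlgL Q q G).step x ans = Sum.inl (Q (boolPair x (List.replicate ans.length true))) := by
  simp [ttFnAlgL, h]

/-- The step of `ttFnAlgL` after all answers is the output on the coded transcript. [folklore] -/
theorem ttFnAlgL_step_of_le (x : List Bool) {ans : List (List Bool)} (h : q.eval x.length ≤ ans.length) :
    (ttFnAlgL Q q G).step x ans = Sum.inr (G (boolPair x ((encodingList Bool).listBool.encode ans))) := by
  simp [ttFnAlgL, Nat.not_lt.2 h]

/-- **The transcript of `ttFnAlgL` against an arbitrary oracle** is the list of the oracle's
answers to the intended queries. [folklore] -/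
theorem trans_ttFnAlgL (O : Oracle) (x : List Bool) :
    ∀ i ≤ q.eval x.length, trans (ttFnAlgL Q q G) O x i = (ttQueries Q x i).map O
  | 0, _ => by simp
  | i + 1, hi => by
    have ih := trans_ttFnAlgL O x i (Nat.le_of_succ_le hi)
    have hlen : (List.map O (ttQueries Q x i)).length = i := by rw [List.length_map, length_ttQueries]
    rw [trans_succ, ih, qryOf_eq_of_step_eq (ttFnAlgL_step_of_lt x (by rw [hlen]; omega)), hlen,
      ttQueries_succ, List.map_append, List.map_singleton]

/-- **`ttFnAlgL` computes `ttFnL`** within any budget of more than `q(|x|)` rounds, against every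
oracle. [Ladner–Lynch–Selman 1975, §3] [cite: LadnerLynchSelman1975, §3] -/
theorem run_ttFnAlgL (O : Oracle) (x : List Bool) {n : ℕ} (hn : q.eval x.length < n) :
    (ttFnAlgL Q q G).run O n x = some (ttFnL Q q G O x) := by
  rw [run_eq_some_iff]
  refine ⟨q.eval x.length, hn, fun i hi => ⟨Q (boolPair x (List.replicate i true)), ?_⟩, ?_⟩
  · rw [trans_ttFnAlgL O x i hi.le, ttFnAlgL_step_of_lt x (by simpa using hi), List.length_map,
      length_ttQueries]
  · rw [trans_ttFnAlgL O x _ le_rfl, ttFnAlgL_step_of_le x (by simp)]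
    rfl

/-- **The queries of `ttFnAlgL` are the intended ones**: every recorded query is `Q ⟨x, 1ⁱ⟩` for some
`i < q(|x|)`, whatever the oracle and the budget. [folklore] -/
theorem exists_of_mem_queries_ttFnAlgL (O : Oracle) (x : List Bool) {n : ℕ} {y : List Bool}
    (hy : y ∈ (ttFnAlgL Q q G).queries O n x) :
    ∃ i < q.eval x.length, y = Q (boolPair x (List.replicate i true)) := by
  obtain ⟨i, -, hall, rfl⟩ := exists_of_mem_queries _ _ n x y hy
  have hi : i < q.eval x.length := by
    by_contra hle
    obtain ⟨y', hy'⟩ := hall (q.eval x.length) (Nat.not_lt.1 hle)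
    rw [trans_ttFnAlgL O x _ le_rfl, ttFnAlgL_step_of_le x (by simp)] at hy'
    cases hy'
  refine ⟨i, hi, ?_⟩
  rw [trans_ttFnAlgL O x i hi.le, qryOf_eq_of_step_eq (ttFnAlgL_step_of_lt x (by simpa using hi)),
    List.length_map, length_ttQueries]

/-- Every query of `ttFnAlgL` is an intended query (list form). [folklore] -/
theorem mem_ttQueries_of_mem_queries_ttFnAlgL (O : Oracle) (x : List Bool) {n : ℕ} {y : List Bool}
    (hy : y ∈ (ttFnAlgL Q q G).queries O n x) : y ∈ ttQueries Q x (q.eval x.length) := by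
  obtain ⟨i, hi, rfl⟩ := exists_of_mem_queries_ttFnAlgL O x hy
  exact (mem_ttQueries_iff x _ _).2 ⟨i, hi, rfl⟩

/-! ### The step function of `ttFnAlgL` as a string map -/

variable (G) in
/-- The code `1 · G ⟨x, code of the answers⟩` of the output: `G` applied to the step input itself. [folklore] -/
def outL : List Bool → List Bool := List.cons true ∘ G

variable (Q q G) in
/-- **The step function of `ttFnAlgL` as a string map.** [folklore] -/
noncomputable def stepSL : List Bool → List Bool := condFn (GoOn q) (qryS Q) (outL G)

/-- `outL G ∈ FP` for `G ∈ FP`. [folklore] -/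
theorem outL_mem_FP (hG : G ∈ FP) : outL G ∈ FP := comp_mem_FP (cons_mem_FP true) hG

/-- **`stepSL ∈ FP`.** [folklore] -/
theorem stepSL_mem_FP (hQ : Q ∈ FP) (hG : G ∈ FP) : stepSL Q q G ∈ FP :=
  condFn_mem_FP (GoOn_mem_P q) (qryS_mem_FP hQ) (outL_mem_FP hG)

/-- **The string map computes the step function.** [folklore] -/
theorem stepSL_apply (x : List Bool) (ans : List (List Bool)) :
    stepSL Q q G (boolPair x ((encodingList Bool).listBool.encode ans)) =
      stepCodeL ((ttFnAlgL Q q G).step x ans) := by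
  by_cases h : ans.length < q.eval x.length
  · rw [stepSL, condFn_of_mem _ _ ((mem_GoOn_iff x ans).2 h), ttFnAlgL_step_of_lt x h, qryS_apply,
      stepCodeL_inl]
  · rw [stepSL, condFn_of_not_mem _ _ (fun h' => h ((mem_GoOn_iff x ans).1 h')),
      ttFnAlgL_step_of_le x (Nat.not_lt.1 h), stepCodeL_inr]
    rfl

/-- **`ttFnAlgL` is polynomial-time** for `Q, G ∈ FP`. [Ladner–Lynch–Selman 1975, §3;
Arora–Barak 2009, §3.4] [cite: LadnerLynchSelman1975, §3] -/
theorem isPolyTime_ttFnAlgL (hQ : Q ∈ FP) (hG : G ∈ FP) :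
    (ttFnAlgL Q q G).IsPolyTime (encodingList Bool) := by
  obtain ⟨p, Mx, h⟩ := stepSL_mem_FP (q := q) hQ hG
  refine ⟨p, Mx, fun z => ?_⟩
  have hz := h (boolPair z.1 ((encodingList Bool).listBool.encode z.2))
  rw [id, stepSL_apply] at hz
  exact hz

/-- **Query lengths**: with an output-length bound `s` of `Q` (`|Q w| ≤ s(|w|)`), every query of
`ttFnAlgL` on `x` has length `≤ s(2|x| + 2 + q(|x|))`. [folklore] -/
theorem length_le_of_mem_queries_ttFnAlgL {s : Polynomial ℕ} (hs : ∀ w, (Q w).length ≤ s.eval w.length)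
    (O : Oracle) (x : List Bool) {n : ℕ} {y : List Bool} (hy : y ∈ (ttFnAlgL Q q G).queries O n x) :
    y.length ≤ s.eval (2 * x.length + 2 + q.eval x.length) := by
  obtain ⟨i, hi, rfl⟩ := exists_of_mem_queries_ttFnAlgL O x hy
  refine (hs _).trans ?_
  rw [length_boolPair, List.length_replicate]
  exact TM2Iter.eval_mono s (by omega)

end TTFnL

end Literature.Computability.Complexity
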